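/- Copyright: the b2b-balaban cell (near-miss cell 7), T⁴-continuum fan-out, NE7b swarm leaf 04 (gen 6; road W-RP, sub-row
«W3k»: the two-level law at every coarse block-boundary cut).  Released under the licence of the surrounding project. -/
import Summits.QuantumFields.BalabanUV.T4Continuum.Support.HistoryRPTower
import Literature.MathematicalPhysics.QuantumFieldTheory.Balaban1983to89.T4UndoubledRP

/-!
# History chessboard road: the two-level law `(U, Ū)` at EVERY coarse block-boundary cut (W3k)

Summits-side support leaf of the T⁴-continuum cell (rung (B)+1 on a FINITE torus only; NOT infinite volume, NOT the
mass gap, NOT the Clay statement; NOT a proof of the spine estimate NE7b).  Road W-RP (R-OWNER-23-2 ∕ R-OWNER-23-8) of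
the swarm claim table `t4/b2b-balaban-t4-ne7b-p1/LEAVES-NE7b.md`, sub-row «W3k» (journal INTENT of leaf-04 g6), on top
of W3i∕W3j (`HistoryRPTwoLevel`, `HistoryRPTower`), W3c (`HistoryRPBase.rpPackage_conj`) and W3h
(`HistoryRPGibbsState`, leaf-06 g5).  [folklore] transport bookkeeping; KERNEL lane (no `def`, no `structure`, no
`[cite:]` tag); no constant (c2∕c6), no exit ∕ socket ∕ `HistoryConstants` file (c3); nothing printed asserted.

WHY.  W3i gives the RP-package of the joint law `μ.map (U ↦ (U, av.avg U))` at the CENTRE cut `−1 ∣ 0` of each axis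
`ρ`.  The chessboard estimate (W5∕W4b′) wants every block-boundary hyperplane.  The two-level law is invariant under
the PAIRED translations `Φ_a := (τ_{L·a}, τ_a)`, `a : Site P (j+1)` — base translation invariance plus the tree's
`blockAvg_translate` («averaging commutes with block translations», [B12] (2.17) shape) — so W3c's transport
`rpPackage_conj` carries the centre-cut package to the cut `L·a_ρ − 1 ∣ L·a_ρ`, i.e. to EVERY block boundary of level
`j+1` (the plain-coordinate twin of W3g for the averaging map and of W3h file 3 (A) for the level-0 state).

WHAT.
* §1 the paired translation `Prod.map (translate (Site.scale a)) (translate a)`: measurable, inverse `a ↦ −a`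
  (`prodTranslate_inv`), and a symmetry of the two-level law (`measurePreserving_prodTranslate_twoLevel`) under base
  translation invariance and «`av` commutes with block translations».
* §2 **`rpPackage_twoLevel_cut`**: the five-member RP-package of `μ.map (U ↦ (U, av.avg U))` for the translated positive
  algebra `((mPos G j ρ).prod (mPos G (j+1) ρ)).comap Φ_a` and the translated reflection
  `p ↦ (τ_{−L·a} (c_ρ (τ_{L·a} p.1)), τ_{−a} (c_ρ (τ_a p.2)))`, for any measurable two-block-local `av` commuting with the
  centre reflection and with block translations; `rpPackage_twoLevel_cut_blockAvg` for Bałaban's (0.4) (tree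
  `blockAvg_creflect`, `blockAvg_translate`, `twoBlockLocal_blockAvg`).
* §3 **`rpPackage_twoLevel_gibbs_cut_SU`**: the `SU(n)` Wilson–Gibbs state at level 0 (translation invariance BY NAME
  from W3h's `measurePreserving_gibbsMeasure_of_isExpectSymmetry` + the tree's `Missing.IsExpectSymmetry.translate`;
  centre-cut package from W3j's `rpPackage_twoLevel_gibbs_SU`): hypothesis-free up to `0 ≤ β`, `1 ≤ m + K`,
  measurable `E`.

HONEST SCOPE.  Transport over W3i∕W3j∕W3h and W3c's `rpPackage_conj`; the cuts are parametrised by coarse lattice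
vectors `a` in the cell's `Setup` letters — the dictionary to W3e's cell-torus families `(i, k)` on `BlockIdx d N` is
the instantiating seat's (as for W3g∕W3h); (EXT)∕(LOC)-for-events, (R-sym), (U1)∕(G2), the cutoff-tower identification
stay displayed; the typing identification «`blockAvg ℰ` is Bałaban's (0.4)» is T-class.  NE7b NOT proved; spine 0∕9.
HONEST DEPENDENCY (cell): continuum YM on T⁴ ⇐ BetaPertH ∧ nine spine estimates (0/9 proved); BetaPertH ⇐ (D1) ∧ (D4)
∧ CAP+tail; G-an2-4 gates asym, D1 and NE2/3/4.  This file changes none of it. -/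

open MeasureTheory ProbabilityTheory
open Literature.MathematicalPhysics.QuantumFieldTheory
open Literature.MathematicalPhysics.QuantumFieldTheory.Balaban1983to89
open Literature.MathematicalPhysics.QuantumFieldTheory.LatticeRP (IsReflectionPositiveBdd)
open BlockAveraging T4ReflectionConeSharp T4UndoubledRP
open Summit.QuantumFields.BalabanUV.T4Continuum.HistoryRPHalfTorus
open Summit.QuantumFields.BalabanUV.T4Continuum.HistoryRPAveraging
open Summit.QuantumFields.BalabanUV.T4Continuum.HistoryRPTwoLevel
open Summit.QuantumFields.BalabanUV.T4Continuum.HistoryRPTower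

namespace Summit.QuantumFields.BalabanUV.T4Continuum.HistoryRPTwoLevelCuts

noncomputable section

variable {P : Params} {j : ℕ} {G : Type*}

/-! ## §1 The paired translation is a symmetry of the two-level law -/

section Symmetry

/-- the paired translation undone by the opposite one (fine factor: `scale` is additive). [folklore] -/
theorem prodTranslate_inv (a : Site P (j + 1)) (p : GaugeField P j G × GaugeField P (j + 1) G) :
    Prod.map (GaugeField.translate (Site.scale (-a))) (GaugeField.translate (-a))
        (Prod.map (GaugeField.translate (Site.scale a)) (GaugeField.translate a) p) = p := by
  obtain ⟨U, V⟩ := p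
  simp only [Prod.map_apply, GaugeField.translate_translate, map_neg, neg_add_cancel, GaugeField.translate_zero]

/-- … and conversely. [folklore] -/
theorem prodTranslate_inv' (a : Site P (j + 1)) (p : GaugeField P j G × GaugeField P (j + 1) G) :
    Prod.map (GaugeField.translate (Site.scale a)) (GaugeField.translate a)
        (Prod.map (GaugeField.translate (Site.scale (-a))) (GaugeField.translate (-a)) p) = p := by
  simpa only [neg_neg] using prodTranslate_inv (-a) p

variable [MeasurableSpace G]

/-- the paired translation is measurable. [folklore] -/
theorem measurable_prodTranslate (a : Site P (j + 1)) :
    Measurable (Prod.map (GaugeField.translate (Site.scale a)) (GaugeField.translate a) :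
      GaugeField P j G × GaugeField P (j + 1) G → GaugeField P j G × GaugeField P (j + 1) G) :=
  (measurable_translate _).prodMap (measurable_translate _)

variable [GaugeGroup G]

/-- **THE PAIRED TRANSLATION IS A SYMMETRY OF THE TWO-LEVEL LAW**: if the base state is invariant under the fine
translation `τ_{L·a}` and the averaging commutes with block translations (`av.avg (τ_{L·a} U) = τ_a (av.avg U)`, the
tree's `blockAvg_translate` shape), then `(τ_{L·a}, τ_a)` preserves `μ.map (U ↦ (U, av.avg U))`. [folklore] -/
theorem measurePreserving_prodTranslate_twoLevel {av : Averaging P j G} (hA : Measurable av.avg) (a : Site P (j + 1))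
    (hAT : ∀ U : GaugeField P j G, av.avg (U.translate (Site.scale a)) = (av.avg U).translate a)
    {μ : Measure (GaugeField P j G)} (hT : MeasurePreserving (GaugeField.translate (Site.scale a)) μ μ) :
    MeasurePreserving (Prod.map (GaugeField.translate (Site.scale a)) (GaugeField.translate a))
      (μ.map fun U => (U, av.avg U)) (μ.map fun U => (U, av.avg U)) :=
  measurePreserving_map_of_semiconj hT (measurable_prodTranslate a) (measurable_id.prodMk hA) fun U => by
    simp only [Prod.map_apply, hAT]

end Symmetry

/-! ## §2 The two-level package at the cut translated by `a` -/

section Cut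

variable [GaugeGroup G] [MeasurableSpace G]

/-- **THE TWO-LEVEL LAW AT THE CUT `L·a_ρ − 1 ∣ L·a_ρ`** (abstract averaging): the five-member RP-package of
`μ.map (U ↦ (U, av.avg U))` for the translated positive algebra `((mPos G j ρ).prod (mPos G (j+1) ρ)).comap (τ_{L·a}, τ_a)`
and the translated reflection `(τ_{−L·a} ∘ c_ρ ∘ τ_{L·a}, τ_{−a} ∘ c_ρ ∘ τ_a)` — W3i's centre-cut package transported by
W3c's `rpPackage_conj` along the symmetry of §1. [folklore] -/
theorem rpPackage_twoLevel_cut [MeasurableInv G] (hj : j + 1 ≤ P.m + P.K) (ρ : Fin P.d) {av : Averaging P j G}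
    (hA : Measurable av.avg) (hL : TwoBlockLocal av)
    (hR : ∀ U : GaugeField P j G, av.avg (U.creflect ρ) = (av.avg U).creflect ρ) (a : Site P (j + 1))
    (hAT : ∀ U : GaugeField P j G, av.avg (U.translate (Site.scale a)) = (av.avg U).translate a)
    {μ : Measure (GaugeField P j G)} [IsFiniteMeasure μ]
    (hθ : MeasurePreserving (GaugeField.creflect ρ) μ μ)
    (hRP : IsReflectionPositiveBdd μ (mPos G j ρ) (GaugeField.creflect ρ))
    (hT : MeasurePreserving (GaugeField.translate (Site.scale a)) μ μ) :
    ((mPos G j ρ).prod (mPos G (j + 1) ρ)).comap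
          (Prod.map (GaugeField.translate (Site.scale a)) (GaugeField.translate a)) ≤
        (inferInstance : MeasurableSpace (GaugeField P j G × GaugeField P (j + 1) G)) ∧
      Measurable (fun p : GaugeField P j G × GaugeField P (j + 1) G =>
        (((p.1.translate (Site.scale a)).creflect ρ).translate (Site.scale (-a)),
          ((p.2.translate a).creflect ρ).translate (-a))) ∧
      MeasurePreserving (fun p : GaugeField P j G × GaugeField P (j + 1) G =>
          (((p.1.translate (Site.scale a)).creflect ρ).translate (Site.scale (-a)),
            ((p.2.translate a).creflect ρ).translate (-a)))
        (μ.map fun U => (U, av.avg U)) (μ.map fun U => (U, av.avg U)) ∧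
      ((fun p : GaugeField P j G × GaugeField P (j + 1) G =>
          (((p.1.translate (Site.scale a)).creflect ρ).translate (Site.scale (-a)),
            ((p.2.translate a).creflect ρ).translate (-a))) ∘
        (fun p : GaugeField P j G × GaugeField P (j + 1) G =>
          (((p.1.translate (Site.scale a)).creflect ρ).translate (Site.scale (-a)),
            ((p.2.translate a).creflect ρ).translate (-a))) = id) ∧
      IsReflectionPositiveBdd (μ.map fun U => (U, av.avg U))
        (((mPos G j ρ).prod (mPos G (j + 1) ρ)).comap
          (Prod.map (GaugeField.translate (Site.scale a)) (GaugeField.translate a)))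
        (fun p : GaugeField P j G × GaugeField P (j + 1) G =>
          (((p.1.translate (Site.scale a)).creflect ρ).translate (Site.scale (-a)),
            ((p.2.translate a).creflect ρ).translate (-a))) := by
  obtain ⟨hle, hΘm, hΘ, hΘΘ, h5⟩ := rpPackage_twoLevel hj ρ hA hL hR hθ hRP
  exact HistoryRPBase.rpPackage_conj hle hΘm hΘ hΘΘ h5 (measurable_prodTranslate a) (measurable_prodTranslate (-a))
    (measurePreserving_prodTranslate_twoLevel hA a hAT hT).map_eq (prodTranslate_inv' a) (prodTranslate_inv a)

/-- **THE TWO-LEVEL LAW OF BAŁABAN'S (0.4) AT EVERY COARSE BLOCK-BOUNDARY CUT** (tree `blockAvg ℰ`: (LOC) by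
`twoBlockLocal_blockAvg`, (γ) by `blockAvg_creflect`, block translations by `blockAvg_translate`). [folklore] -/
theorem rpPackage_twoLevel_cut_blockAvg [RegularGaugeGroup G] (hj : j + 1 ≤ P.m + P.K) (ρ : Fin P.d)
    (ℰ : LoopAverage G) (hE : ∀ n, Measurable fun W : Fin (n + 1) → G => ℰ.E W) (a : Site P (j + 1))
    {μ : Measure (GaugeField P j G)} [IsFiniteMeasure μ]
    (hθ : MeasurePreserving (GaugeField.creflect ρ) μ μ)
    (hRP : IsReflectionPositiveBdd μ (mPos G j ρ) (GaugeField.creflect ρ))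
    (hT : MeasurePreserving (GaugeField.translate (Site.scale a)) μ μ) :
    ((mPos G j ρ).prod (mPos G (j + 1) ρ)).comap
          (Prod.map (GaugeField.translate (Site.scale a)) (GaugeField.translate a)) ≤
        (inferInstance : MeasurableSpace (GaugeField P j G × GaugeField P (j + 1) G)) ∧
      Measurable (fun p : GaugeField P j G × GaugeField P (j + 1) G =>
        (((p.1.translate (Site.scale a)).creflect ρ).translate (Site.scale (-a)),
          ((p.2.translate a).creflect ρ).translate (-a))) ∧
      MeasurePreserving (fun p : GaugeField P j G × GaugeField P (j + 1) G =>
          (((p.1.translate (Site.scale a)).creflect ρ).translate (Site.scale (-a)),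
            ((p.2.translate a).creflect ρ).translate (-a)))
        (μ.map fun U => (U, (blockAvg (P := P) (j := j) ℰ).avg U))
        (μ.map fun U => (U, (blockAvg (P := P) (j := j) ℰ).avg U)) ∧
      ((fun p : GaugeField P j G × GaugeField P (j + 1) G =>
          (((p.1.translate (Site.scale a)).creflect ρ).translate (Site.scale (-a)),
            ((p.2.translate a).creflect ρ).translate (-a))) ∘
        (fun p : GaugeField P j G × GaugeField P (j + 1) G =>
          (((p.1.translate (Site.scale a)).creflect ρ).translate (Site.scale (-a)),
            ((p.2.translate a).creflect ρ).translate (-a))) = id) ∧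
      IsReflectionPositiveBdd (μ.map fun U => (U, (blockAvg (P := P) (j := j) ℰ).avg U))
        (((mPos G j ρ).prod (mPos G (j + 1) ρ)).comap
          (Prod.map (GaugeField.translate (Site.scale a)) (GaugeField.translate a)))
        (fun p : GaugeField P j G × GaugeField P (j + 1) G =>
          (((p.1.translate (Site.scale a)).creflect ρ).translate (Site.scale (-a)),
            ((p.2.translate a).creflect ρ).translate (-a))) :=
  rpPackage_twoLevel_cut hj ρ (measurable_avgFun ℰ hE) (twoBlockLocal_blockAvg ℰ) (blockAvg_creflect ℰ ρ) a
    (blockAvg_translate ℰ a) hθ hRP hT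

end Cut

/-! ## §3 The `SU(n)` Wilson–Gibbs state at level 0 -/

section Gibbs

variable {n : ℕ} [NeZero n]

/-- **THE JOINT LAW OF THE `SU(n)` GIBBS STATE AND ITS BLOCK AVERAGE (0.4) IS REFLECTION POSITIVE AT EVERY COARSE
BLOCK-BOUNDARY CUT OF EVERY AXIS** (RP member; the other four members come with `rpPackage_twoLevel_cut_blockAvg`):
translation invariance of the level-0 Gibbs state BY NAME from W3h (`measurePreserving_gibbsMeasure_of_isExpectSymmetry`
+ the tree's `Missing.IsExpectSymmetry.translate`), centre-cut base package from W3h's `rpPackage_gibbs_creflect_SU`.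
Hypothesis-free up to `0 ≤ β`, `1 ≤ m + K`, measurable `E`. [folklore] -/
theorem isReflectionPositiveBdd_twoLevel_gibbs_cut_SU (P : Params) {β : ℝ} (hβ : 0 ≤ β) (hK : 0 + 1 ≤ P.m + P.K)
    (ρ : Fin P.d) (ℰ : LoopAverage (Matrix.specialUnitaryGroup (Fin n) ℂ))
    (hE : ∀ k, Measurable fun W : Fin (k + 1) → Matrix.specialUnitaryGroup (Fin n) ℂ => ℰ.E W) (a : Site P (0 + 1)) :
    IsReflectionPositiveBdd
      ((T4GenFunBounds.gibbsMeasure (G := Matrix.specialUnitaryGroup (Fin n) ℂ) P β).map fun U =>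
        (U, (blockAvg (P := P) (j := 0) ℰ).avg U))
      (((mPos (Matrix.specialUnitaryGroup (Fin n) ℂ) 0 ρ).prod (mPos (Matrix.specialUnitaryGroup (Fin n) ℂ) (0 + 1) ρ)).comap
        (Prod.map (GaugeField.translate (Site.scale a)) (GaugeField.translate a)))
      (fun p : GaugeField P 0 (Matrix.specialUnitaryGroup (Fin n) ℂ) ×
          GaugeField P (0 + 1) (Matrix.specialUnitaryGroup (Fin n) ℂ) =>
        (((p.1.translate (Site.scale a)).creflect ρ).translate (Site.scale (-a)),
          ((p.2.translate a).creflect ρ).translate (-a))) := by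
  haveI := T4GenFunBounds.isProbabilityMeasure_gibbsMeasure (G := Matrix.specialUnitaryGroup (Fin n) ℂ) P hβ
  obtain ⟨-, -, hθ, -, hRP⟩ := HistoryRPGibbs.rpPackage_gibbs_creflect_SU (n := n) P hβ ρ
  have hT : MeasurePreserving (GaugeField.translate (Site.scale a))
      (T4GenFunBounds.gibbsMeasure (G := Matrix.specialUnitaryGroup (Fin n) ℂ) P β)
      (T4GenFunBounds.gibbsMeasure (G := Matrix.specialUnitaryGroup (Fin n) ℂ) P β) :=
    HistoryRPGibbsState.measurePreserving_gibbsMeasure_of_isExpectSymmetry hβ (measurable_translate _)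
      (Missing.IsExpectSymmetry.translate _)
  exact (rpPackage_twoLevel_cut_blockAvg hK ρ ℰ hE a hθ hRP hT).2.2.2.2

end Gibbs

end

end Summit.QuantumFields.BalabanUV.T4Continuum.HistoryRPTwoLevelCuts
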